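import Summits.CriticalPhenomena.PercolationContinuityZ3.Theorems.PercNearOneGluingNoHeavyQuantOneArmRevealmentSusc
import HarnessLib

/-!
# QUANT lane (p4 gen 22): the REVEALMENT (O'Donnell–Servedio / "adaptive Moore–Shannon") total-variation modulus of the
# cluster law — `sup_B |P_p(B) − P_{p'}(B)| ≤ θ_n(p) + θ_n(p') + (p'−p)·√(2d·χ_n^Λ(p')/(4p(1−p')))`

builds on p205010 (kernel theorem, internal audit signed; external expert review pending) — NOT used in this file.

Sequel of `…QuantClusterLawLevelOne` (level-1 modulus with the box edge count `#ℰ(Λ_n)`): the same architecture with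
the O'Donnell–Servedio revealment inequality (tree: `Strategy.os_sum_cov_le_strategy`, gen 14) for the exploration of the
cluster of the origin inside `Λ_n` (DRT's seed exploration `SeedExploration.strategy`, seed `{0}`, gen 13/20) in place
of the Bessel/level-1 inequality: the edge count `#ℰ(Λ_n) ≍ n^d` is replaced by the REVEALMENT SUM
`≤ 2d·χ_n^Λ(p)`, `χ_n^Λ(p) = Σ_{a∈Λ_n} P_p(0 ↔ a in Λ_n) ≤ E_p[|C| ∧ |Λ_n|]` — the square root of the MEAN truncated volume
(census V81 of P4-MODULUS §27; mean-field bookkeeping at `p_c`: `t^{2/3}` against `t^{4/(d+4)}` (level 1) and `√t`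
(optimised volume form) — heuristic only, no exponent is claimed).

* §1 the cluster read on the box cube (`SeedConn {0}`), the labels of the exploration (`Active {0}`), halting correctness
  `label_eq_of_halt'`, the revealment majorant, the variance bound;
* §2 **`sum_cov_le_sqrt`** — `Σ_e E_p[G_𝒜·φ_e] ≤ √(¼·p(1−p)·2d·χ_n^Λ(p))` for every family `𝒜` (O'Donnell–Servedio);
* (sequel file `…QuantClusterLawRevealmentModulus`: §3 bridges to `P_p` and the derivative bound, §4 the TV modulus).

HONEST: new as typed (bookkeeping on the tree's OS inequality and seed exploration); no rate.
-/

noncomputable section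

namespace Summit.CriticalPhenomena.PercolationContinuityZ3.Theorems.ClusterLaw

open MeasureTheory Finset Function Literature.Probability.Percolation Literature.Probability.LatticeModels
open Literature.Probability.ODonnellSaksSchrammServedio2005 Literature.Probability.ODonnellSaksSchrammServedio2005.Strategy
open Literature.Probability.Percolation.OneArmOSSS Literature.Probability.Percolation.SeedExploration
open Literature.Probability.Percolation.GhostExploration
open scoped Classical

variable {d : ℕ}

/-- `cl⁻¹ 𝒜`: the cluster event `{ω | C(0)(ω) ∈ 𝒜}`. -/
local notation3 (prettyPrint := false) "cl⁻¹" 𝒜:arg => (fun ω : BondConfig (Site d) => openCluster ω (0 : Site d)) ⁻¹' 𝒜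

/-- `cubeCl[n, x]`: the cluster of the origin read on the box cube input `x` (vertices of `Λ_n` joined to `0` by open lattice
edges of `x`), as a set of sites. -/
local notation3 (prettyPrint := false) "cubeCl[" n ", " x "]" =>
  (Subtype.val '' {v : BoxV d n | SeedConn (latEdge d n) {origin d n} x v} : Set (Site d))

/-- `G[n, 𝒜]`: the indicator of `{cubeCl ∈ 𝒜}` on the cube. -/
local notation3 (prettyPrint := false) "G[" n ", " 𝒜 "]" => fun x : PairIdx d n → Bool => if cubeCl[n, x] ∈ 𝒜 then (1 : ℝ) else 0

/-- `L[n, 𝒜]`: the leaf labels of the seed exploration — the indicator that the ACTIVE set (queried-open cluster of `0`)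
lies in `𝒜`. -/
local notation3 (prettyPrint := false) "L[" n ", " 𝒜 "]" => fun σ : PairIdx d n → Option Bool =>
  if (Subtype.val '' {v : BoxV d n | Active (latEdge d n) {origin d n} σ v} : Set (Site d)) ∈ 𝒜 then (1 : ℝ) else 0

/-- `Aloc[n, 𝒜]`: the local event `{ω | cubeCl[n, ω|_{Λ_n}] ∈ 𝒜}`. -/
local notation3 (prettyPrint := false) "Aloc[" n ", " 𝒜 "]" => {ω : BondConfig (Site d) | cubeCl[n, toCube n ω] ∈ 𝒜}

/-- `χΛ[n, p] = Σ_{a ∈ Λ_n} P_p(0 ↔ a in Λ_n)`, the box susceptibility. -/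
local notation3 (prettyPrint := false) "χΛ[" n ", " p "]" =>
  ∑ a ∈ box d n, (bondPercolation (zdGraph d) p).real (openConnIn (↑(box d n) : Set (Site d)) 0 a)

/-- `θn[p, n] = P_p(0 ↔ ∂Λ_n)`. -/
local notation3 (prettyPrint := false) "θn[" p ", " n "]" => (bondPercolation (zdGraph d) p).real (siteToBoundary d n)

/-! ### §1 The exploration of the cluster of the origin: labels, halting, revealment, variance -/

/-- **Halting correctness**: at a halting state of the seed-`{0}` exploration consistent with the input, the active set IS the
cluster of the origin, so the label equals `G`. -/
theorem label_eq_of_halt' (n : ℕ) (𝒜 : Set (Set (Site d))) (σ : PairIdx d n → Option Bool) (x : PairIdx d n → Bool)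
    (hc : Consistent σ x) (hh : SeedExploration.strategy (latEdge d n) {origin d n} σ = none) : L[n, 𝒜] σ = G[n, 𝒜] x := by
  unfold SeedExploration.strategy at hh
  split_ifs at hh with h
  simp only [not_exists, not_and] at h
  have key : {v : BoxV d n | Active (latEdge d n) {origin d n} σ v} =
      {v : BoxV d n | SeedConn (latEdge d n) {origin d n} x v} := by
    ext v
    constructor
    · intro hv; exact seedConn_of_active hc hv
    · rintro ⟨u, hu, hr⟩
      have h'' : ∀ e, σ e = none → ∀ a b, latEdge d n a b = some e → ¬Active (latEdge d n) {origin d n} σ a :=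
        fun e he a b hab => h e he a b hab
      exact ⟨u, hu, sReach_of_yReach_of_noPending hc h'' hu hr⟩
  simp only [key]

/-- `0 ≤ seedProb`. -/
theorem seedProb_nonneg'' (n : ℕ) (p : unitInterval) (Z : Set (BoxV d n)) (a : BoxV d n) :
    0 ≤ seedProb (latEdge d n) (boxBias d n p) Z a :=
  Finset.sum_nonneg fun x _ => mul_nonneg (wt_nonneg (boxBias_nonneg n p.2.1) (boxBias_le_one n p.2.2) x)
    (by split_ifs <;> norm_num)

/-- The number of LATTICE pairs of the box containing a given site is at most `2d`. -/
theorem card_filter_mem_lattice_le' (n : ℕ) (a : Site d) :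
    ((Finset.univ : Finset (PairIdx d n)).filter fun e => a ∈ e.1 ∧ e.1 ∈ (zdGraph d).edgeSet).card ≤ 2 * d := by
  calc ((Finset.univ : Finset (PairIdx d n)).filter fun e => a ∈ e.1 ∧ e.1 ∈ (zdGraph d).edgeSet).card
      ≤ ((zdGraph d).incidenceFinset a).card := by
        refine Finset.card_le_card_of_injOn (fun e => e.1) (fun e he => ?_) (fun e _ e' _ h => Subtype.ext h)
        rw [Finset.coe_filter, Set.mem_setOf_eq] at he
        rw [Finset.mem_coe, SimpleGraph.mem_incidenceFinset]
        exact ⟨he.2.2, he.2.1⟩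
    _ ≤ 2 * d := by
        rw [SimpleGraph.card_incidenceFinset_eq_degree]
        exact Literature.Probability.LatticeModels.card_neighborFinset_zdGraph_le a

/-- **Revealment majorant**: the exploration queries the pair `e` only if a vertex of `e` is joined to `0`:
`δ_e ≤ Σ_{a ∈ e} P(a ↔ 0)` (`= 0` for non-lattice pairs). -/
theorem revealment_le_sum_seedProb (n : ℕ) (p : unitInterval) (𝒜 : Set (Set (Site d))) (e : PairIdx d n) :
    revealment (boxBias d n p) (SeedExploration.strategy (latEdge d n) {origin d n}) (L[n, 𝒜]) e ≤
      ∑ a ∈ (Finset.univ : Finset (BoxV d n)).filter (fun a => a.1 ∈ e.1),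
        seedProb (latEdge d n) (boxBias d n p) {origin d n} a := by
  have h0 := boxBias_nonneg (d := d) n p.2.1
  have h1 := boxBias_le_one (d := d) n p.2.2
  have h := revealment_le h0 h1 (SeedExploration.strategy (latEdge d n) {origin d n}) (L[n, 𝒜]) e
    (fun x => ∃ a : BoxV d n, a.1 ∈ e.1 ∧ SeedConn (latEdge d n) {origin d n} x a) (fun σ x hc hq => by
      obtain ⟨a, b, hab, hg⟩ := seedConn_of_query hc hq
      obtain ⟨-, he⟩ := latEdge_eq_some_iff.1 hab
      exact ⟨a, by rw [he]; exact Sym2.mem_mk_left _ _, hg⟩)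
  refine h.trans ?_
  unfold seedProb
  rw [Finset.sum_comm]
  refine Finset.sum_le_sum fun x _ => ?_
  rw [← Finset.mul_sum]
  refine mul_le_mul_of_nonneg_left ?_ (wt_nonneg h0 h1 x)
  split_ifs with hx
  · obtain ⟨a, ha, hga⟩ := hx
    have hmem : a ∈ (Finset.univ : Finset (BoxV d n)).filter (fun a => a.1 ∈ e.1) := by
      rw [Finset.mem_filter]; exact ⟨Finset.mem_univ _, ha⟩
    have hle := Finset.single_le_sum (s := (Finset.univ : Finset (BoxV d n)).filter (fun a => a.1 ∈ e.1))
      (f := fun a' : BoxV d n => if SeedConn (latEdge d n) {origin d n} x a' then (1 : ℝ) else 0)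
      (fun a' _ => by split_ifs <;> norm_num) hmem
    simp only [if_pos hga] at hle
    exact hle
  · exact Finset.sum_nonneg fun a _ => by split_ifs <;> norm_num

/-- **The revealment sum**: `Σ_e δ_e·b_e(1−b_e) ≤ p(1−p)·2d·χ_n^Λ(p)`. -/
theorem sum_revealment_le (n : ℕ) (p : unitInterval) (𝒜 : Set (Set (Site d))) :
    ∑ e ∈ (Finset.univ : Finset (PairIdx d n)),
        revealment (boxBias d n p) (SeedExploration.strategy (latEdge d n) {origin d n}) (L[n, 𝒜]) e *
          (boxBias d n p e * (1 - boxBias d n p e)) ≤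
      (p : ℝ) * (1 - p) * (2 * d * χΛ[n, p]) := by
  set b := boxBias d n p with hb
  set R : PairIdx d n → ℝ := fun e => ∑ a ∈ (Finset.univ : Finset (BoxV d n)).filter (fun a => a.1 ∈ e.1),
    seedProb (latEdge d n) b {origin d n} a with hR
  have hR0 : ∀ e, 0 ≤ R e := fun e => Finset.sum_nonneg fun a _ => seedProb_nonneg'' n p _ a
  have hrev : ∀ e, revealment b (SeedExploration.strategy (latEdge d n) {origin d n}) (L[n, 𝒜]) e ≤ R e :=
    fun e => revealment_le_sum_seedProb n p 𝒜 e
  have hbb : ∀ e, 0 ≤ b e * (1 - b e) := fun e =>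
    mul_nonneg (boxBias_nonneg n p.2.1 e) (sub_nonneg.2 (boxBias_le_one n p.2.2 e))
  calc ∑ e ∈ (Finset.univ : Finset (PairIdx d n)), revealment b (SeedExploration.strategy (latEdge d n) {origin d n}) (L[n, 𝒜]) e *
          (b e * (1 - b e))
      ≤ ∑ e ∈ (Finset.univ : Finset (PairIdx d n)), R e * (b e * (1 - b e)) :=
        Finset.sum_le_sum fun e _ => mul_le_mul_of_nonneg_right (hrev e) (hbb e)
    _ ≤ _ := by
        have hterm : ∀ e : PairIdx d n, R e * (b e * (1 - b e)) =
            (p : ℝ) * (1 - p) * (if e.1 ∈ (zdGraph d).edgeSet then R e else 0) := by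
          intro e
          rw [hb]; unfold boxBias
          split_ifs <;> ring
        simp only [hterm, ← Finset.mul_sum]
        refine mul_le_mul_of_nonneg_left ?_ (mul_nonneg p.2.1 (sub_nonneg.2 p.2.2))
        rw [← Finset.sum_filter]
        have hswap : ∑ e ∈ (Finset.univ : Finset (PairIdx d n)).filter (fun e => e.1 ∈ (zdGraph d).edgeSet), R e =
            ∑ a : BoxV d n, ∑ e ∈ (Finset.univ : Finset (PairIdx d n)).filter
              (fun e => a.1 ∈ e.1 ∧ e.1 ∈ (zdGraph d).edgeSet), seedProb (latEdge d n) b {origin d n} a := by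
          rw [hR]
          rw [Finset.sum_comm' (t' := Finset.univ)
            (s' := fun a => (Finset.univ : Finset (PairIdx d n)).filter (fun e => a.1 ∈ e.1 ∧ e.1 ∈ (zdGraph d).edgeSet))]
          intro e a
          simp only [Finset.mem_filter, Finset.mem_univ, true_and]
          tauto
        rw [hswap]
        calc ∑ a : BoxV d n, ∑ e ∈ (Finset.univ : Finset (PairIdx d n)).filter
              (fun e => a.1 ∈ e.1 ∧ e.1 ∈ (zdGraph d).edgeSet), seedProb (latEdge d n) b {origin d n} a
            = ∑ a : BoxV d n, (((Finset.univ : Finset (PairIdx d n)).filter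
                (fun e => a.1 ∈ e.1 ∧ e.1 ∈ (zdGraph d).edgeSet)).card : ℝ) * seedProb (latEdge d n) b {origin d n} a := by
              simp [Finset.sum_const, nsmul_eq_mul]
          _ ≤ ∑ a : BoxV d n, (2 * d : ℝ) * (bondPercolation (zdGraph d) p).real
                (openConnIn (↑(box d n) : Set (Site d)) 0 a.1) := by
              refine Finset.sum_le_sum fun a _ => mul_le_mul ?_ (OneArmOS.seedProb_origin_le n p a)
                (seedProb_nonneg'' n p _ a) (by positivity)
              exact_mod_cast card_filter_mem_lattice_le' n a.1
          _ = 2 * d * χΛ[n, p] := by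
              rw [Finset.mul_sum, ← Finset.sum_coe_sort (box d n)]

/-- **Variance of an indicator**: `Σ_x w(x)(G(x) − E G)² ≤ 1/4`. -/
theorem sum_wt_indicator_sub_sq_le (n : ℕ) (p : unitInterval) (𝒜 : Set (Set (Site d))) :
    ∑ x, wt (boxBias d n p) x * (G[n, 𝒜] x - ∑ y, wt (boxBias d n p) y * G[n, 𝒜] y) ^ 2 ≤ 1 / 4 := by
  set b := boxBias d n p
  have h0 := boxBias_nonneg (d := d) n p.2.1
  have h1 := boxBias_le_one (d := d) n p.2.2
  set m : ℝ := ∑ y, wt b y * G[n, 𝒜] y with hm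
  have hG2 : ∀ x : PairIdx d n → Bool, (G[n, 𝒜] x) ^ 2 = G[n, 𝒜] x := fun x => by
    simp only; split_ifs <;> norm_num
  have hexp : ∀ x : PairIdx d n → Bool, wt b x * (G[n, 𝒜] x - m) ^ 2 =
      wt b x * G[n, 𝒜] x - 2 * m * (wt b x * G[n, 𝒜] x) + m ^ 2 * wt b x := fun x => by
    have := hG2 x
    ring_nf
    rw [show (G[n, 𝒜] x) ^ 2 = G[n, 𝒜] x from this]
    ring
  have hsum : ∑ x, wt b x * (G[n, 𝒜] x - m) ^ 2 = m - m ^ 2 := by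
    simp only [hexp, Finset.sum_add_distrib, Finset.sum_sub_distrib, ← Finset.mul_sum, sum_wt, ← hm]
    ring
  rw [hsum]
  nlinarith [sq_nonneg (m - 1 / 2)]

/-! ### §2 The O'Donnell–Servedio bound for the cluster indicator -/

/-- **`Σ_e E_p[G_𝒜·φ_e] ≤ √(¼ · p(1−p) · 2d · χ_n^Λ(p))`** for every family `𝒜`: O'Donnell–Servedio's inequality for the
exploration of the cluster of the origin in `Λ_n` (revealment sum `≤ p(1−p)·2dχ_n^Λ`, variance `≤ ¼`). -/
theorem sum_cov_le_sqrt (n : ℕ) (p : unitInterval) (𝒜 : Set (Set (Site d))) :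
    ∑ e ∈ (Finset.univ : Finset (PairIdx d n)), ∑ x, wt (boxBias d n p) x * (G[n, 𝒜] x * ctr (boxBias d n p) e x) ≤
      Real.sqrt (1 / 4 * ((p : ℝ) * (1 - p) * (2 * d * χΛ[n, p]))) := by
  have h0 := boxBias_nonneg (d := d) n p.2.1
  have h1 := boxBias_le_one (d := d) n p.2.2
  have os := os_sum_cov_le_strategy (boxBias d n p) h0 h1 (strategy_legal (latEdge d n) {origin d n}) (L[n, 𝒜])
    (g := G[n, 𝒜]) (fun σ x hc hh => label_eq_of_halt' n 𝒜 σ x hc hh) Finset.univ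
  refine os.trans (Real.sqrt_le_sqrt ?_)
  have hv := sum_wt_indicator_sub_sq_le (d := d) n p 𝒜
  have hr := sum_revealment_le (d := d) n p 𝒜
  have hv0 : 0 ≤ ∑ x, wt (boxBias d n p) x * (G[n, 𝒜] x - ∑ y, wt (boxBias d n p) y * G[n, 𝒜] y) ^ 2 :=
    Finset.sum_nonneg fun x _ => mul_nonneg (wt_nonneg h0 h1 x) (sq_nonneg _)
  have hr0 : 0 ≤ ∑ e ∈ (Finset.univ : Finset (PairIdx d n)),
      revealment (boxBias d n p) (SeedExploration.strategy (latEdge d n) {origin d n}) (L[n, 𝒜]) e *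
        (boxBias d n p e * (1 - boxBias d n p e)) :=
    Finset.sum_nonneg fun e _ => mul_nonneg (Finset.sum_nonneg fun x _ => mul_nonneg (wt_nonneg h0 h1 x)
      (by split_ifs <;> norm_num)) (mul_nonneg (h0 e) (sub_nonneg.2 (h1 e)))
  exact mul_le_mul hv hr hr0 (by norm_num)

end Summit.CriticalPhenomena.PercolationContinuityZ3.Theorems.ClusterLaw
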